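import Summits.QuantumFields.YangMills.Theorems.BalabanUVNodesK0AxComplexGaussianRatioBounds

/-!
# K0ᴬ∕K0⁷ — THE COMPLEX-GAUSSIAN RATIO STABILITY BRICK (CGRS) for DEF-1's `gaussRatioC`: numerator, denominator floor, ratio and `R − 1` bounds
(◇ lens-1 g13 NODE v14 «N4-R ⟸ CGRS brick + four model faces»; generic, model-free, Mathlib-only; consumer = FE-2 of ⟨27930⟩ via N4-R of v13.2∕v13.3)

LANDING NOTE (porter ▶ PTC-1 g4, 2026-08-31; AUTHORSHIP = ◇ lens-1 g13 «cauchy-analytic», HOME file `nodeO-cover/LENS-1g13-ComplexGaussianRatio-v1.lean` sha16 db60d35763c9169f · 583 l. · 34 thm +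
2 def (CANDIDATE 1 of g13 — NODE v14 wall N4-R ⟸ «CGRS», the complex-Gaussian ratio stability brick for ★★ DEF-1's total carrier `gaussRatioC` of ✓p824829 `…K0RecordFormatNamesFluctRatioC`)): the
HOME file exceeds the gate's 400-line cap, so it is landed as THREE files by a MECHANICAL split at the §4∕§5 and §6∕§7 boundaries (generator `work/gen/build_split_cgr.py` of this seat; header
docblock, preamble, docstrings, statements and proofs BYTE-IDENTICAL; the only new lines are this paragraph, the chained `import`, and the closing `end`s):
`…Theorems/BalabanUVNodesK0AxComplexGaussianRatioBounds.lean` (PART A = header + §1 real∕imaginary parts (`quadFormR`, `gaussNormR`) + §2 numerator bound + §3 ratio bound from a floor + §4 the `R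
− 1` bound (layer 1)); `…Theorems/BalabanUVNodesK0AxComplexGaussianRatioFrame.lean` (PART B = header + `import …K0AxComplexGaussianRatioBounds` + §5 LAYER 2a congruence frame + §6 LAYER 2b
existence of a congruence frame); `…Theorems/BalabanUVNodesK0AxComplexGaussianRatio.lean` (PART C (◇'s basename; the finals) = header + `import …K0AxComplexGaussianRatioFrame` + §7 LAYER 2c
denominator (`gaussNormC_floor`) + §8 the assembled brick (`norm_gaussRatioC_le_exp_trace`, `gaussNormC_ne_zero`, `norm_gaussRatioC_sub_one_le_trace`)).  THIS FILE: PART B = header + `import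
…K0AxComplexGaussianRatioBounds` + §5 LAYER 2a congruence frame + §6 LAYER 2b existence of a congruence frame.  ◆ CRIT-1 g38's cut: «(b) CUT — ◇ CANDIDATE 1 (g13) db60d35763c9169f · 583 l. · 34
thm · 2 def → GO VERBATIM `--supports stmt-QuantumFields-27930 --as helper` (definition lane because of the 2 defs); probe `g38/CGR_probe.lean` (file + 34 `#guard_msgs … #print axioms` std guards)
rc 0 · 0 err · 0 warn · 0 sorry; J4 name-dedup 36 names × {Summits, Literature, HarnessLib} = 0; stmt-dedup: `quadFormR` no `def` twin (25 inline-sum hits), `gaussNormR` none, `Pᵀ * A * P = 1` ONE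
hit = `Summits/HubbardSuperconductivity/…/BalabanIRBirComplexStableXYFixedVolumeGauss.lean` :58 `birGauss_exists_congruence (hA : A.PosDef) (hB : B.IsHermitian)` + :160 `birGauss_integral_ne_zero`
— the SAME congruence-frame ∕ non-vanishing device in ANOTHER summit (not importable across Summits; no FQN clash) ⇒ rider R-i: cited HERE as the in-tree precedent of layer 2's qualitative half;
J1′: `gaussNormR`'s Bochner-junk `0` SAID (:79) and REMOVED where used (`gaussNormC_floor` delivers `0 < gaussNormR (Re M)` ∧ `Integrable …` under `(Re M).PosDef`), every regime hypothesis
displayed; the floor inequality checked on paper: ‖gaussNormC‖∕gaussNormR = Π_j (1+σ_j²)^{−¼} ≥ Π_j e^{−σ_j²∕4} by `1 + u ≤ e^u`, Σσ_j² = tr(A⁻¹BA⁻¹B) in any congruence frame — TRUE and SECOND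
ORDER in Im M; (R-a) `gaussNormC_ne_zero` makes DEF-1's `gaussRatioC` quotient genuine on {Re M ≻ 0}; SAME-WALL: located-A = a KERNEL-PROVED model-free stability brick for the TOTAL carrier,
located-B UNCHANGED = N4-R's model faces + N8b; NOT a tautology, SURVIVES priced S» (nodeO STATUS 2026-08-31T15:07:19Z) and «(1) RE-KEY — CGRS GO ONTO ▶'s SPLIT (INTENT-80): (A) 370ab4c5247b1ad5 ·
251 · 11 thm + 2 def, (B) 6270cc2ca952ba59 · 258 · 13 thm, (C) 7ba7bf850559a672 · 210 · 10 thm (pre-stamp bytes + this paragraph), chain A → B → C each behind its own dry-run ACCEPT; declcmp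
monolith vs A∕B∕C = 13 SAME · 0 DIFF ∕ 13 SAME · 0 DIFF ∕ 10 SAME · 0 DIFF, 0 ONLY-B, 13+13+10 = 36 = all decls» (2026-08-31T15:10:09Z); `--supports stmt-QuantumFields-27930 --as helper` (NO
`--workitem`).  HONEST (porter): Mathlib-only theorems about parametric Gaussian integrals over `ι → ℝ`; nothing of Bałaban asserted, ported, discharged or refuted; the four MODEL faces and the
holomorphy half of N4-R are NOT here; `stub_FE`∕`stub_P0C` and the crux ⟨27930⟩ OPEN; K0⁷ 20541 ∕ K0ᴬ 27238 ∕ K1ᴬ ∕ K3ᴬ OPEN — NOTHING of them proved; NODE O 0∕1; COUNT 8∕28 · K 1∕4 UNMOVED;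
finite 𝕋⁴ at fixed ε — NOT continuum ∕ OS ∕ Clay; the Yang–Mills mass gap is NOT proved by any of this.  ERRATUM (gate lint, mechanical, declared): the HOME file's bib key `Brydges1986Course` does
not exist in `lean/references.bib`; the tree's key for the SAME source (D. C. Brydges, «A short course on cluster expansions», Les Houches 1984 Session XLIII, North-Holland 1986, pp. 129–183) is
`Brydges1986` — PART B's first dry-run BOUNCED `lint` on it (15:11Z), so in PARTS B and C every occurrence of `Brydges1986Course` is replaced by `Brydges1986` (1 in the header docblock, 6 in
§5–§6, 7 in §7–§8; nothing else touched); PART A landed before the bounce with the old key in non-leading cite positions (cosmetic, same source).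

[I] = [Balaban1987RG1], [II] = [Balaban1988RG2Cluster], [Br] = [Brydges1986].

WHAT.  For DEF-1's TOTAL carriers `gaussIntC χ M E`, `gaussNormC M`, `gaussRatioC χ M E` (✓p824829 `…K0RecordFormatNamesFluctRatioC`: a complex matrix `M` over a finite index type `ι`,
evaluated at REAL points, Lebesgue reference measure) this file PROVES the absolute-value half of print's «the analytically continued expectation is holomorphic and bounded by
`e^{O(1)|X|}` on the polydisc `|s_□| ≤ e^{κ}`» ([II] (1.13)–(1.14) p.5; [Br] §3), as a MODEL-FREE brick with every regime hypothesis displayed: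
* LAYER 1 (§1–§4, inequalities from a denominator floor): `norm_gaussIntegrand` — `‖χ(x)·exp(−½·quadC M x + E x)‖ = |χ x|·exp(−½·quadFormR (Re M) x + Re (E x))` (the imaginary parts
  cost NOTHING in modulus); ★ (ii) `norm_gaussIntC_le` — `0 ≤ χ ≤ 1`, `Re E ≤ η` on `{χ ≠ 0}` ⟹ `‖gaussIntC χ M E‖ ≤ e^{η}·gaussNormR (Re M)`; ★ (iii) `norm_gaussRatioC_le_exp` — plus a floor
  `e^{−τ}·gaussNormR (Re M) ≤ ‖gaussNormC M‖` ⟹ `‖gaussRatioC χ M E‖ ≤ e^{η+τ}`; ★ (iv) `norm_gaussRatioC_sub_one_le` — plus `‖exp(E x) − 1‖ ≤ η₁` on `{χ ≠ 0}` and a Gaussian TAIL budget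
  `∫(1−χ)e^{−½quadFormR} ≤ T·gaussNormR` ⟹ `‖gaussRatioC χ M E − 1‖ ≤ e^{τ}(η₁ + T)`.
* LAYER 2 (§5–§7, what `τ` IS): ★★ `gaussNormC_eq_of_frame` — in a congruence frame `P` (real, invertible) bringing `½·quadC M` to `Σ_j b_j w_j²`, `Re b_j > 0`:
  `gaussNormC M = |det P|·Π_j (π∕b_j)^{½}` (Lebesgue measure under `toLin' P`, `Real.map_matrix_volume_pi_eq_smul_volume_pi`, + Mathlib's one-dimensional complex Gaussians
  `GaussianFourier.integral_cexp_neg_sum_mul_add`); ★★ `exists_congruenceFrame` — for real symmetric `A ≻ 0`, `B`: `∃ P σ, PᵀAP = 1 ∧ PᵀBP = diagonal σ` (spectral theorem twice, Mathlib's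
  `eigenvectorUnitary`); `sum_sq_eq_trace_of_frame` — `Σ_j σ_j² = tr(A⁻¹BA⁻¹B)` (basis-free); ★★★ `norm_gaussNormC_frame` — `‖gaussNormC M‖ = |det P|·Π_j √(2π)∕(1+σ_j²)^{¼}` and
  `gaussNormR (Re M) = |det P|·(√(2π))^{n}`; ★★★ `gaussNormC_floor` — for `Re M ≻ 0`, `Im M` symmetric: `gaussNormC M ≠ 0`, `0 < gaussNormR (Re M)`, the real Gaussian is integrable, and
  THE SECOND-ORDER FLOOR `exp(−¼·tr((Re M)⁻¹(Im M)(Re M)⁻¹(Im M)))·gaussNormR (Re M) ≤ ‖gaussNormC M‖` (`1 + u ≤ e^{u}`).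
* ASSEMBLED (§8): ★★★ `norm_gaussRatioC_le_exp_trace` — `‖gaussRatioC χ M E‖ ≤ exp(η + ¼·tr((Re M)⁻¹(Im M)(Re M)⁻¹(Im M)))`; `gaussNormC_ne_zero`; `norm_gaussRatioC_sub_one_le_trace`.
WHY THE COMPLEX NORMALISATION IS THE RIGHT CARRIER (design remark for DEF-1∕N1): the modulus of the numerator only sees `Re M`; the modulus of the complex normalisation is SMALLER than
the real one only by `Π(1+σ_j²)^{−¼} ≥ e^{−¼Σσ_j²}` — SECOND order in `Im M` — whereas a fixed real normalisation would pay the FIRST-order shift `det(A + Re δM)∕det A`.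
CONSUMER (N4-R of ◇ v13.2∕v13.3, FE-2 of ⟨27930⟩): with `M := piecesFormC … (recordSWeight … s) ψ`, `χ := chiRem …`, the model owes FOUR faces in its own currency — (F-coer) `Re M(s,ψ) ≻ 0`
on `cpoly(e^{κ₁}) × recordUc` (coercivity margin (E3)), (F-im) the Hilbert–Schmidt budget `tr((Re M)⁻¹(Im M)(Re M)⁻¹(Im M)) ≤ 4θ·|c|`, (F-int) `Re E ≤ η·|c|` on `supp χ`, (F-tail) the cut-off
tail budget `T` — and then `c_R := η + θ`; NONE of them is asserted here.

HONEST FRAMING.  Mathlib-only theorems about parametric Gaussian integrals over `ι → ℝ`; junk discipline ◆ (R-a) respected (layer 1 ASSUMES the regime where used, layer 2 PROVES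
non-vanishing∕positivity∕integrability under `Re M ≻ 0`; no `def … : Prop` letter).  Nothing of Bałaban is asserted, ported or discharged; the four MODEL faces and the holomorphy half of
N4-R are NOT here; `stub_FE`∕`stub_P0C` OPEN, ⟨27930⟩ OPEN; K0⁷∕K0ᴬ∕K1ᴬ∕K3ᴬ OPEN; NODE O 0∕1; finite `𝕋⁴_{L^K}` at fixed ε — NOT continuum∕OS; **the Yang–Mills mass gap (Clay) is NOT
proved by any of this.**  No `sorry`, `instance`, `notation`, `structure`, `private`; standard axioms.
-/

noncomputable section

open scoped BigOperators
open MeasureTheory Complex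

namespace Summit.QuantumFields.YangMills.Theorems.K0AxComplexGaussianRatio

open Summit.QuantumFields.YangMills.Theorems.K0RecordFormatNames (quadC gaussIntC gaussNormC gaussRatioC)

variable {ι : Type*} [Fintype ι]

/-! ## §5  LAYER 2a — the Gaussian integral in a CONGRUENCE FRAME (linear change of variables + Mathlib's one-dimensional complex Gaussians) -/

section Frame

open Matrix

/-- The real form as a dot product. [cite: Balaban1987RG1, (2.12) p.268 (bookkeeping)] -/
theorem quadFormR_eq_dotProduct (A : Matrix ι ι ℝ) (x : ι → ℝ) : quadFormR A x = x ⬝ᵥ (A *ᵥ x) := by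
  unfold quadFormR
  simp only [dotProduct, Matrix.mulVec, Finset.mul_sum]
  exact Finset.sum_congr rfl fun i _ => Finset.sum_congr rfl fun j _ => by ring

/-- ★ **CONGRUENCE**: `quadFormR A (P·w) = quadFormR (Pᵀ A P) w`. [cite: Balaban1988RG2Cluster, (1.9)–(1.10) p.4 (bookkeeping)] -/
theorem quadFormR_mulVec (A P : Matrix ι ι ℝ) (w : ι → ℝ) : quadFormR A (P *ᵥ w) = quadFormR (Pᵀ * A * P) w := by
  rw [quadFormR_eq_dotProduct, quadFormR_eq_dotProduct, ← Matrix.mulVec_mulVec, ← Matrix.mulVec_mulVec,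
    Matrix.dotProduct_mulVec _ Pᵀ, Matrix.vecMul_transpose]

/-- The complex form at a real point, split into real and imaginary parts. [cite: Balaban1988RG2Cluster, (1.9)–(1.10) p.4 (bookkeeping)] -/
theorem quadC_eq_re_add_im (M : Matrix ι ι ℂ) (x : ι → ℝ) :
    quadC M x = (quadFormR (M.map Complex.re) x : ℂ) + (quadFormR (M.map Complex.im) x : ℂ) * Complex.I := by
  rw [← re_quadC, ← im_quadC, Complex.re_add_im]

/-- `quadFormR 1 w = Σ w_j²` and `quadFormR (diagonal σ) w = Σ σ_j w_j²`. [cite: Balaban1987RG1, (2.12) p.268 (bookkeeping)] -/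
theorem quadFormR_diagonal [DecidableEq ι] (σ : ι → ℝ) (w : ι → ℝ) : quadFormR (Matrix.diagonal σ) w = ∑ j, σ j * w j ^ 2 := by
  unfold quadFormR
  refine Finset.sum_congr rfl fun i _ => ?_
  rw [Finset.sum_eq_single i]
  · rw [Matrix.diagonal_apply_eq]; ring
  · intro j _ hji; rw [Matrix.diagonal_apply_ne _ (Ne.symm hji)]; ring
  · intro h; exact absurd (Finset.mem_univ i) h

/-- `quadFormR 1 w = Σ w_j²`. [cite: Balaban1987RG1, (2.12) p.268 (bookkeeping)] -/
theorem quadFormR_one [DecidableEq ι] (w : ι → ℝ) : quadFormR (1 : Matrix ι ι ℝ) w = ∑ j, w j ^ 2 := by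
  rw [← Matrix.diagonal_one, quadFormR_diagonal]; simp

/-- The complex form is continuous in the real point. [cite: Balaban1987RG1, (2.12) p.268 (bookkeeping)] -/
theorem continuous_quadC_real (M : Matrix ι ι ℂ) : Continuous fun x : ι → ℝ => quadC M x := by
  unfold quadC
  fun_prop

/-- The real form is continuous. [cite: Balaban1987RG1, (2.12) p.268 (bookkeeping)] -/
theorem continuous_quadFormR (A : Matrix ι ι ℝ) : Continuous fun x : ι → ℝ => quadFormR A x := by
  unfold quadFormR
  fun_prop

/-- ★★ **LAYER 2a — THE GAUSSIAN INTEGRAL IN A CONGRUENCE FRAME**: if an invertible real `P` brings `½·quadC M` to the diagonal form `Σ_j b_j w_j²` with `Re b_j > 0`, then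
`gaussNormC M = |det P| · Π_j (π ∕ b_j)^{1∕2}` (principal branch, factor by factor).  Proof: `Real.map_matrix_volume_pi_eq_smul_volume_pi` (Lebesgue measure under `toLin' P`) +
`integral_cexp_neg_sum_mul_add` (Mathlib's product of one-dimensional complex Gaussians). [cite: Balaban1987RG1, (2.12) p.268; Brydges1986, §3] -/
theorem gaussNormC_eq_of_frame [DecidableEq ι] (M : Matrix ι ι ℂ) (P : Matrix ι ι ℝ) (hP : P.det ≠ 0) (b : ι → ℂ)
    (hb : ∀ j, 0 < (b j).re) (hM : ∀ w : ι → ℝ, (1 / 2 : ℂ) * quadC M (P *ᵥ w) = ∑ j, b j * (w j : ℂ) ^ 2) :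
    gaussNormC M = ((|P.det| : ℝ) : ℂ) * ∏ j, ((Real.pi : ℂ) / b j) ^ (1 / 2 : ℂ) := by
  -- the integral in the frame is Mathlib's product of one-dimensional complex Gaussians
  have key : ∫ w : ι → ℝ, Complex.exp (-(1 / 2 : ℂ) * quadC M (P *ᵥ w)) = ∏ j, ((Real.pi : ℂ) / b j) ^ (1 / 2 : ℂ) := by
    have h := GaussianFourier.integral_cexp_neg_sum_mul_add hb (fun _ => 0)
    simp only [zero_mul, Finset.sum_const_zero, add_zero, ne_eq, OfNat.ofNat_ne_zero, not_false_eq_true, zero_pow, zero_div,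
      Complex.exp_zero, mul_one] at h
    rw [← h]
    refine integral_congr_ae (Filter.Eventually.of_forall fun w => ?_)
    show Complex.exp (-(1 / 2 : ℂ) * quadC M (P *ᵥ w)) = Complex.exp (-∑ j, b j * (w j : ℂ) ^ 2)
    rw [neg_mul, hM]
  -- the change of variables `x = P·w`
  set f : (ι → ℝ) → ℂ := fun x => Complex.exp (-(1 / 2 : ℂ) * quadC M x) with hf
  have hfc : Continuous f := Complex.continuous_exp.comp (continuous_const.mul (continuous_quadC_real M))
  have hφ : Measurable (Matrix.toLin' P) := (LinearMap.continuous_of_finiteDimensional _).measurable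
  have hmap := Real.map_matrix_volume_pi_eq_smul_volume_pi hP
  have h1 : ∫ w : ι → ℝ, f (Matrix.toLin' P w) = (((|P.det|⁻¹ : ℝ)) : ℂ) * ∫ x, f x := by
    rw [← integral_map hφ.aemeasurable hfc.aestronglyMeasurable, hmap, integral_smul_measure,
      ENNReal.toReal_ofReal (abs_nonneg _), abs_inv, Complex.real_smul]
  have habs : (((|P.det| : ℝ)) : ℂ) ≠ 0 := by
    exact_mod_cast (abs_pos.2 hP).ne'
  calc gaussNormC M = ∫ x, f x := rfl
    _ = (((|P.det| : ℝ)) : ℂ) * ∫ w : ι → ℝ, f (Matrix.toLin' P w) := by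
        rw [h1, ← mul_assoc, Complex.ofReal_inv, mul_inv_cancel₀ habs, one_mul]
    _ = (((|P.det| : ℝ)) : ℂ) * ∏ j, ((Real.pi : ℂ) / b j) ^ (1 / 2 : ℂ) := by
        simp only [hf, Matrix.toLin'_apply]
        rw [key]

/-- Integrability of the real Gaussian transports along a frame: if `Pᵀ A P = 1` with `P` invertible then `x ↦ e^{−½ quadFormR A x}` is integrable.
[cite: Balaban1987RG1, (2.12) p.268; Brydges1986, §3] -/
theorem integrable_gaussR_of_frame [DecidableEq ι] (A P : Matrix ι ι ℝ) (hP : P.det ≠ 0) (h1 : Pᵀ * A * P = 1) :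
    Integrable (fun x : ι → ℝ => Real.exp (-(1 / 2 : ℝ) * quadFormR A x)) := by
  set g : (ι → ℝ) → ℝ := fun x => Real.exp (-(1 / 2 : ℝ) * quadFormR A x) with hg
  have hgc : Continuous g := Real.continuous_exp.comp (continuous_const.mul (continuous_quadFormR A))
  have hφ : Measurable (Matrix.toLin' P) := (LinearMap.continuous_of_finiteDimensional _).measurable
  have hmap := Real.map_matrix_volume_pi_eq_smul_volume_pi hP
  -- in the frame the Gaussian is a product of one-dimensional Gaussians
  have hcomp : Integrable (g ∘ Matrix.toLin' P) := by
    have hprod : Integrable (fun w : ι → ℝ => ∏ j, Real.exp (-(1 / 2 : ℝ) * w j ^ 2)) :=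
      Integrable.fintype_prod (f := fun _ (t : ℝ) => Real.exp (-(1 / 2 : ℝ) * t ^ 2)) fun _ => integrable_exp_neg_mul_sq (by norm_num)
    refine hprod.congr (Filter.Eventually.of_forall fun w => ?_)
    show ∏ j, Real.exp (-(1 / 2 : ℝ) * w j ^ 2) = g (Matrix.toLin' P w)
    rw [hg, Matrix.toLin'_apply]
    simp only
    rw [quadFormR_mulVec, h1, quadFormR_one, Finset.mul_sum, Real.exp_sum]
  have hne : ENNReal.ofReal |(P.det)⁻¹| ≠ 0 := by
    rw [ne_eq, ENNReal.ofReal_eq_zero, not_le, abs_inv]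
    exact inv_pos.2 (abs_pos.2 hP)
  have hmapint : Integrable g (Measure.map (Matrix.toLin' P) volume) :=
    (integrable_map_measure hgc.aestronglyMeasurable hφ.aemeasurable).2 hcomp
  rw [hmap] at hmapint
  exact (integrable_smul_measure hne ENNReal.ofReal_ne_top).1 hmapint

end Frame

/-! ## §6  LAYER 2b — EXISTENCE OF A CONGRUENCE FRAME (spectral theorem twice: `A = U·D·Uᵀ`, then `D^{−½}UᵀBUD^{−½} = V·Σ·Vᵀ`) -/

section FrameExists

open Matrix

variable [DecidableEq ι]

/-- For a real symmetric matrix, the spectral theorem in the form `Uᵀ A U = diagonal d` with `Uᵀ U = 1` (Mathlib's `eigenvectorUnitary`).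
[cite: Brydges1986, §3 (bookkeeping: linear algebra)] -/
theorem exists_orthogonal_diagonalisation (A : Matrix ι ι ℝ) (hA : A.IsHermitian) :
    ∃ U : Matrix ι ι ℝ, Uᵀ * U = 1 ∧ Uᵀ * A * U = Matrix.diagonal hA.eigenvalues := by
  refine ⟨(hA.eigenvectorUnitary : Matrix ι ι ℝ), ?_, ?_⟩
  · have h := Unitary.coe_star_mul_self hA.eigenvectorUnitary
    rwa [Matrix.star_eq_conjTranspose, Matrix.conjTranspose_eq_transpose_of_trivial] at h
  · have h := hA.conjStarAlgAut_star_eigenvectorUnitary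
    rw [Unitary.conjStarAlgAut_star_apply, Matrix.star_eq_conjTranspose,
      Matrix.conjTranspose_eq_transpose_of_trivial, RCLike.ofReal_real_eq_id] at h
    rw [h]
    rfl

/-- ★★ **LAYER 2b — A CONGRUENCE FRAME EXISTS**: for real symmetric `A ≻ 0` and real symmetric `B` there are an invertible real `P` and reals `σ` with `Pᵀ A P = 1` and `Pᵀ B P = diagonal σ`
(simultaneous reduction of the pair `(A, B)`; `σ` = the eigenvalues of `A^{−½} B A^{−½}`). [cite: Brydges1986, §3 (bookkeeping: linear algebra)] -/
theorem exists_congruenceFrame (A B : Matrix ι ι ℝ) (hA : A.PosDef) (hB : B.IsSymm) :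
    ∃ P : Matrix ι ι ℝ, ∃ σ : ι → ℝ, Pᵀ * A * P = 1 ∧ Pᵀ * B * P = Matrix.diagonal σ := by
  obtain ⟨U, hUU, hU⟩ := exists_orthogonal_diagonalisation A hA.1
  -- normalise the eigenvalues of `A`
  set c : ι → ℝ := fun j => (Real.sqrt (hA.1.eigenvalues j))⁻¹ with hc
  set Q : Matrix ι ι ℝ := U * Matrix.diagonal c with hQ
  have hQt : Qᵀ = Matrix.diagonal c * Uᵀ := by rw [hQ, Matrix.transpose_mul, Matrix.diagonal_transpose]
  have hQA : Qᵀ * A * Q = 1 := by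
    rw [hQt, hQ]
    calc Matrix.diagonal c * Uᵀ * A * (U * Matrix.diagonal c)
        = Matrix.diagonal c * (Uᵀ * A * U) * Matrix.diagonal c := by simp only [Matrix.mul_assoc]
      _ = Matrix.diagonal c * Matrix.diagonal hA.1.eigenvalues * Matrix.diagonal c := by rw [hU]
      _ = Matrix.diagonal (fun j => c j * hA.1.eigenvalues j * c j) := by rw [Matrix.diagonal_mul_diagonal, Matrix.diagonal_mul_diagonal]
      _ = 1 := by
          rw [← Matrix.diagonal_one]
          congr 1
          funext j
          have hd : 0 < hA.1.eigenvalues j := hA.eigenvalues_pos j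
          have hs : Real.sqrt (hA.1.eigenvalues j) ≠ 0 := (Real.sqrt_pos.2 hd).ne'
          rw [hc]
          field_simp
          rw [Real.sq_sqrt hd.le]
  -- diagonalise `S := Qᵀ B Q`
  set S : Matrix ι ι ℝ := Qᵀ * B * Q with hS
  have hBh : B.IsHermitian := by
    show Bᴴ = B
    rw [Matrix.conjTranspose_eq_transpose_of_trivial]
    exact hB.eq
  have hSh : S.IsHermitian := by
    have h := Matrix.isHermitian_conjTranspose_mul_mul Q hBh
    rwa [Matrix.conjTranspose_eq_transpose_of_trivial] at h
  obtain ⟨V, hVV, hV⟩ := exists_orthogonal_diagonalisation S hSh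
  refine ⟨Q * V, hSh.eigenvalues, ?_, ?_⟩
  · rw [Matrix.transpose_mul]
    calc Vᵀ * Qᵀ * A * (Q * V) = Vᵀ * (Qᵀ * A * Q) * V := by simp only [Matrix.mul_assoc]
      _ = 1 := by rw [hQA, Matrix.mul_one, hVV]
  · rw [Matrix.transpose_mul]
    calc Vᵀ * Qᵀ * B * (Q * V) = Vᵀ * (Qᵀ * B * Q) * V := by simp only [Matrix.mul_assoc]
      _ = Matrix.diagonal hSh.eigenvalues := by rw [← hS, hV]

/-- In a frame, `det P² · det A = 1`; in particular `P` is invertible. [cite: Brydges1986, §3 (bookkeeping)] -/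
theorem det_sq_mul_det_of_frame (A P : Matrix ι ι ℝ) (h1 : Pᵀ * A * P = 1) : P.det ^ 2 * A.det = 1 ∧ P.det ≠ 0 := by
  have h := congr_arg Matrix.det h1
  rw [Matrix.det_mul, Matrix.det_mul, Matrix.det_transpose, Matrix.det_one] at h
  have h' : P.det ^ 2 * A.det = 1 := by rw [← h]; ring
  refine ⟨h', fun h0 => ?_⟩
  rw [h0] at h'
  norm_num at h'

/-- ★ In a frame the Hilbert–Schmidt sum of `σ` is the BASIS-FREE trace `tr(A⁻¹BA⁻¹B)`. [cite: Brydges1986, §3 (bookkeeping)] -/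
theorem sum_sq_eq_trace_of_frame (A B P : Matrix ι ι ℝ) (σ : ι → ℝ) (h1 : Pᵀ * A * P = 1) (h2 : Pᵀ * B * P = Matrix.diagonal σ) :
    ∑ j, σ j ^ 2 = (A⁻¹ * B * A⁻¹ * B).trace := by
  -- `A⁻¹ = P Pᵀ`
  have hPA : (P * Pᵀ) * A = 1 := by
    have h : (Pᵀ * A) * P = 1 := by rw [← h1]
    have h' : P * (Pᵀ * A) = 1 := mul_eq_one_comm.1 h
    rw [← Matrix.mul_assoc] at h'
    exact h'
  have hinv : A⁻¹ = P * Pᵀ := Matrix.inv_eq_left_inv hPA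
  rw [hinv]
  have hdiag : (Matrix.diagonal σ * Matrix.diagonal σ).trace = ∑ j, σ j ^ 2 := by
    rw [Matrix.diagonal_mul_diagonal, Matrix.trace_diagonal]
    exact Finset.sum_congr rfl fun j _ => by ring
  rw [← hdiag, ← h2]
  calc (Pᵀ * B * P * (Pᵀ * B * P)).trace = ((Pᵀ * B * P * Pᵀ * B) * P).trace := by simp only [Matrix.mul_assoc]
    _ = (P * (Pᵀ * B * P * Pᵀ * B)).trace := Matrix.trace_mul_comm _ _
    _ = (P * Pᵀ * B * (P * Pᵀ) * B).trace := by simp only [Matrix.mul_assoc]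

end FrameExists

end Summit.QuantumFields.YangMills.Theorems.K0AxComplexGaussianRatio

end
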